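import Summits.ResolutionOfSingularities.ResolutionOfSingularities.Theorems.FrobeniusLadderFInjectiveMacaulayficationLocalFullificationFibreAdmGe4Split
import HarnessLib

/-!
# FULL-CENTRE DESCENT ALONG A TOWER OF SUPPORTED BLOWING UPS — the generic, def-free kernel of «Lemma A» of the «TT» programme
# (crux `FInjectiveMacaulayfication` stmt-ResolutionOfSingularities-15315, chain w45a; res-L1-w45a-plan-1 RULING R19.2 (3) «Lemma A
# `IntrinsicTower.exists_fibreCentre_of_towerFull`»; seat res-L1-w45a-lead-1 g9, generic part only — the (TT-K) file proper
# (`…IntrinsicTower.lean`: the desk's `nonFullLocus` / `centre` / `TowerFull` / `IntrinsicTowerConjecture` verbatim, Lemma A by ONE `exact` of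
# `exists_fullCentre_of_tower` below, TT ⇒ F-half, door term) stays res-L1-w45a-stub-2's)

[OURS · L1 W4.5a] Support file (`--supports stmt-ResolutionOfSingularities-15315 --as helper`); NOT a statement of any manuscript; def-free,
fact-free, UNCONDITIONAL; generic in the scheme (no specimen). AI-written (AI review is weaker than expert review).

WHAT IS PROVED. Fix a prime-characteristic label `p` (only the clause `SliceableCentre.FullCl p` depends on it). Say a centre `𝓚` on `S`
«FULL-ifies `S` inside `F`» if `𝓚 ≠ ⊥`, `supp 𝓚 ⊆ F`, and EVERY blowing up of `S` along `𝓚` is FULL at EVERY point (the conclusion shape of the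
F-half `LocalFullificationFibreAdmGe4Split.LocalFInjectivizationFibreAdmGe4`, of `SliceableCentre.CentreData`, and of Lemma A).
* §1 `exists_fullCentre_of_forall_fullCl` — floor zero: a non-empty scheme FULL at every point is FULL-ified inside ANY `F` by `𝓚 = ⊤`
  (its blowing ups are isomorphisms: `IsBlowup.isIso` + `isEffectiveCartier_top`).
* §2 transports along ONE blowing up `g : S₁ ⟶ S` whose centre is supported in a closed `F` off which `S` is FULL: `S₁` is Noetherian
  (`isNoetherian_of_isBlowup`), has a point off `g⁻¹F` if `S` has one off `F` (`exists_not_mem_preimage_of_isBlowup`), and is FULL off `g⁻¹F`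
  (`fullCl_of_not_mem_preimage_of_isBlowup`) — `g` is an isomorphism over `(supp)ᶜ ⊇ Fᶜ` (`IsBlowup.isIso_compl`).
* §3 `exists_fullCentre_of_isBlowup` — ONE DESCENT STEP (Temkin 2008 Lemma 2.1.4 = Stacks 080B, in the tree
  `IsBlowup.exists_isBlowup_comp_supported`, + uniqueness of blowing ups `IsBlowup.unique` + stalk transport
  `FTemkinClosedPoints.fullCl_of_isIso_stalkMap'`): if `S₁` is FULL-ified inside `g⁻¹F` then `S` is FULL-ified inside `F`.
* §4 `vanishingIdeal_support_subset` / `vanishingIdeal_ne_bot` — the reduced ideal sheaf of a closed `C ⊆ F` is supported in `F` and is `≠ ⊥` as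
  soon as some point lies off `F` (`S` reduced) — the DEGENERACY NOTE of R19.2 (2) in kernel form (were `C = S` the centre would be `⊥`).
* §5 **`exists_fullCentre_of_tower`** — THE GENERIC LEMMA A: for ANY centre recipe `c : (S : Scheme) → S.IdealSheafData` supported, on every
  Noetherian integral floor, inside every closed set off which the floor is FULL (`hc`), and ANY tower predicate `T : ℕ → Scheme → Prop` with
  `T 0 S ⇒ S FULL everywhere` (`h0`) and `T (n+1) S ⇒ T n S₁` for every blowing up `S₁ ⟶ S` along `c S` (`hsucc`): if `T n S` holds on a Noetherian
  integral `S` FULL off a closed `F` missing at least one point, then `S` is FULL-ified inside `F` by ONE centre. Induction on `n` generalizing the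
  floor, §1 at `n = 0`, §2 + §3 at `n + 1`. The desk's Lemma A is the instance `T := IntrinsicTower.TowerFull p`, `c := IntrinsicTower.centre p`,
  `hc` := «`supp (vanishingIdeal (closure nonFull)) = closure nonFull ⊆ F`» (§4 with `C := closure (nonFullLocus p S)`), `h0`/`hsucc` := `Iff.rfl`.
HONEST CAVEATS: nothing here says any tower terminates (that is the killable conjecture (TT)); the lemma is recipe-agnostic on purpose (it serves the
τ-tower and the N-tower variants of res-L1-w45a-idea-1 alike); FULL is the crux's stalk clause (domain ∧ CM-clause ∧ F-clause), not F-rationality.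
[folklore assembly; cite: Temkin2008, Lemma 2.1.4] [cite: StacksProject, Tag 080B; Tag 02OS] [cite: GortzWedhorn2020, Def. 13.90, (13.19) p. 413]
-/

-- single-problem summit: the doubled namespace component is forced
set_option linter.dupNamespace false

noncomputable section

open AlgebraicGeometry CategoryTheory CategoryTheory.Limits Literature.AlgebraicGeometry.Resolution TopologicalSpace IsLocalRing

namespace Summit.ResolutionOfSingularities.ResolutionOfSingularities.Theorems.FInjectiveMacaulayfication.FullCentreDescent

open Summit.ResolutionOfSingularities.ResolutionOfSingularities.Theorems.FInjectiveMacaulayfication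
open SliceableCentre

/-! ## §1 Floor zero: a FULL scheme is FULL-ified by the unit ideal -/

/-- On a non-empty scheme the unit ideal sheaf is not the zero ideal sheaf. [folklore] -/
theorem top_ne_bot_of_nonempty (S : Scheme.{0}) [Nonempty S] : (⊤ : S.IdealSheafData) ≠ ⊥ := by
  intro h
  have h1 := congrArg Scheme.IdealSheafData.support h
  rw [Scheme.IdealSheafData.support_top, Scheme.IdealSheafData.support_bot] at h1
  have h2 := congrArg (fun Z : Closeds S => (Z : Set S)) h1
  simp only [Closeds.coe_bot, Closeds.coe_top] at h2
  obtain ⟨s⟩ := (inferInstance : Nonempty S)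
  have hs : s ∈ (Set.univ : Set S) := Set.mem_univ s
  rw [← h2] at hs
  exact hs

/-- **Floor zero.** A non-empty scheme that is FULL at every point is FULL-ified inside ANY set `F` by the unit ideal sheaf: `⊤ ≠ ⊥`, `supp ⊤ = ∅ ⊆ F`,
and every blowing up along `⊤` is an isomorphism, so FULL at every point. [folklore] [cite: GortzWedhorn2020, (13.19) p. 413] -/
theorem exists_fullCentre_of_forall_fullCl (p : ℕ) (S : Scheme.{0}) [Nonempty S] (F : Set S)
    (h : ∀ s : S, FullCl p (S.presheaf.stalk s)) :
    ∃ 𝓚 : S.IdealSheafData, 𝓚 ≠ ⊥ ∧ (∀ s ∈ (𝓚.support : Set S), s ∈ F) ∧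
      ∀ (S'' : Scheme.{0}) (π : S'' ⟶ S), IsBlowup π 𝓚 → ∀ s : S'', FullCl p (S''.presheaf.stalk s) := by
  refine ⟨⊤, top_ne_bot_of_nonempty S, fun s hs => ?_, fun S'' π hπ s => ?_⟩
  · rw [Scheme.IdealSheafData.support_top] at hs
    simp at hs
  · haveI : IsIso π := hπ.isIso isEffectiveCartier_top
    exact FTemkinClosedPoints.fullCl_of_isIso_stalkMap' p π s (h (π.base s))

/-! ## §2 Transports along one supported blowing up -/

/-- The source of a blowing up of a Noetherian scheme is Noetherian (blowing ups of locally Noetherian schemes are proper). [folklore]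
[cite: StacksProject, Tag 02NS] -/
theorem isNoetherian_of_isBlowup {S₁ S : Scheme.{0}} [IsNoetherian S] {g : S₁ ⟶ S} {I : S.IdealSheafData} (hg : IsBlowup g I) :
    IsNoetherian S₁ := by
  haveI : IsProper g := hg.isProper
  haveI : IsLocallyNoetherian S₁ := LocallyOfFiniteType.isLocallyNoetherian g
  haveI : CompactSpace S₁ := QuasiCompact.compactSpace_of_compactSpace g
  exact {}

/-- The stalk maps of a blowing up are isomorphisms at the points over the complement of the support of the centre. [folklore]
[cite: StacksProject, Tag 02OS] -/
theorem isIso_stalkMap_of_isBlowup_of_not_mem {S₁ S : Scheme.{0}} {g : S₁ ⟶ S} {I : S.IdealSheafData} (hg : IsBlowup g I)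
    (s₁ : S₁) (hs₁ : g.base s₁ ∉ (I.support : Set S)) : IsIso (g.stalkMap s₁) := by
  haveI := hg.isIso_compl
  exact RegularBlowupModelDim2.isIso_stalkMap_of_isIso_morphismRestrict g ⟨(I.support : Set S)ᶜ, I.support.isClosed.isOpen_compl⟩ s₁ hs₁

/-- If the centre is supported in `F` and `S` has a point off `F`, the blowing up has a point off `g⁻¹F`. [folklore] [cite: StacksProject, Tag 02OS] -/
theorem exists_not_mem_preimage_of_isBlowup {S₁ S : Scheme.{0}} {g : S₁ ⟶ S} {I : S.IdealSheafData} (hg : IsBlowup g I)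
    (F : Set S) (hIF : (I.support : Set S) ⊆ F) (hne : ∃ s : S, s ∉ F) : ∃ s₁ : S₁, g.base s₁ ∉ F := by
  obtain ⟨s, hs⟩ := hne
  haveI := hg.isIso_compl
  obtain ⟨s₁, hs₁⟩ := RegularBlowupModelDim2.exists_preimage_of_isIso_morphismRestrict g
    ⟨(I.support : Set S)ᶜ, I.support.isClosed.isOpen_compl⟩ s (fun h => hs (hIF h))
  exact ⟨s₁, by rwa [hs₁]⟩

/-- If the centre is supported in `F` and `S` is FULL off `F`, the blowing up is FULL off `g⁻¹F`. [folklore] [cite: StacksProject, Tag 02OS] -/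
theorem fullCl_of_not_mem_preimage_of_isBlowup (p : ℕ) {S₁ S : Scheme.{0}} {g : S₁ ⟶ S} {I : S.IdealSheafData} (hg : IsBlowup g I)
    (F : Set S) (hIF : (I.support : Set S) ⊆ F) (hfull : ∀ s : S, s ∉ F → FullCl p (S.presheaf.stalk s))
    (s₁ : S₁) (hs₁ : g.base s₁ ∉ F) : FullCl p (S₁.presheaf.stalk s₁) := by
  haveI := isIso_stalkMap_of_isBlowup_of_not_mem hg s₁ (fun h => hs₁ (hIF h))
  exact FTemkinClosedPoints.fullCl_of_isIso_stalkMap' p g s₁ (hfull _ hs₁)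

/-! ## §3 One descent step (Temkin 2008, Lemma 2.1.4) -/

/-- **ONE DESCENT STEP.** Let `g : S₁ ⟶ S` be a blowing up of a Noetherian scheme along a centre supported in `F`, with `S₁` integral. If `S₁` is
FULL-ified inside `g⁻¹F` by some centre `𝓚₁` (`𝓚₁ ≠ ⊥`, `supp 𝓚₁ ⊆ g⁻¹F`, every blowing up along `𝓚₁` FULL at every point), then `S` is FULL-ified
inside `F`: blow `S₁` up along `𝓚₁`, contract the two blowing ups to ONE blowing up of `S` along a centre `𝓚` supported in `F` (Temkin 2.1.4 /
Stacks 080B), `𝓚 ≠ ⊥` because the composite's source is integral, and every blowing up along `𝓚` is isomorphic over `S` to the composite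
(uniqueness), whence FULL at every point by stalk transport. [folklore assembly] [cite: Temkin2008, Lemma 2.1.4] [cite: StacksProject, Tag 080B]
[cite: GortzWedhorn2020, (13.19) p. 413] -/
theorem exists_fullCentre_of_isBlowup (p : ℕ) {S₁ S : Scheme.{0}} [IsNoetherian S] [IsIntegral S₁] {g : S₁ ⟶ S} {I : S.IdealSheafData}
    (hg : IsBlowup g I) (F : Set S) (hIF : (I.support : Set S) ⊆ F)
    (h₁ : ∃ 𝓚₁ : S₁.IdealSheafData, 𝓚₁ ≠ ⊥ ∧ (∀ s ∈ (𝓚₁.support : Set S₁), g.base s ∈ F) ∧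
      ∀ (S'' : Scheme.{0}) (π : S'' ⟶ S₁), IsBlowup π 𝓚₁ → ∀ s : S'', FullCl p (S''.presheaf.stalk s)) :
    ∃ 𝓚 : S.IdealSheafData, 𝓚 ≠ ⊥ ∧ (∀ s ∈ (𝓚.support : Set S), s ∈ F) ∧
      ∀ (S'' : Scheme.{0}) (π : S'' ⟶ S), IsBlowup π 𝓚 → ∀ s : S'', FullCl p (S''.presheaf.stalk s) := by
  obtain ⟨𝓚₁, h𝓚₁ne, h𝓚₁F, h𝓚₁full⟩ := h₁
  obtain ⟨S₂, π₂, hπ₂⟩ := exists_isBlowup S₁ 𝓚₁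
  haveI : IsIntegral S₂ := hπ₂.isIntegral h𝓚₁ne
  obtain ⟨𝓚, h𝓚, h𝓚F⟩ := hg.exists_isBlowup_comp_supported g I π₂ 𝓚₁ F hIF hπ₂ (fun s hs => h𝓚₁F s hs)
  refine ⟨𝓚, RegularBlowupModelDim2.ne_bot_of_isBlowup h𝓚, fun s hs => h𝓚F hs, fun S'' π hπ s => ?_⟩
  obtain ⟨e, -, -⟩ := hπ.unique h𝓚
  exact FTemkinClosedPoints.fullCl_of_isIso_stalkMap' p e.hom s (h𝓚₁full S₂ π₂ hπ₂ (e.hom s))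

/-! ## §4 Reduced centres on closed subsets -/

/-- The reduced (vanishing) ideal sheaf of a closed set `C ⊆ F` is supported in `F` (its support IS `C`). [folklore] -/
theorem vanishingIdeal_support_subset {S : Scheme.{0}} (C : Closeds S) (F : Set S) (hCF : (C : Set S) ⊆ F) :
    ((Scheme.IdealSheafData.vanishingIdeal C).support : Set S) ⊆ F := by
  rw [Scheme.IdealSheafData.coe_support_vanishingIdeal]
  exact hCF

/-- **DEGENERACY EXCLUDED.** On a reduced scheme, the reduced ideal sheaf of a closed set `C ⊆ F` is non-zero as soon as some point lies off `F`
(were `C = S`, it would be `⊥` and its blowing up empty). [folklore] -/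
theorem vanishingIdeal_ne_bot {S : Scheme.{0}} [IsReduced S] (C : Closeds S) (F : Set S) (hCF : (C : Set S) ⊆ F) (hne : ∃ s : S, s ∉ F) :
    Scheme.IdealSheafData.vanishingIdeal C ≠ ⊥ := by
  intro h
  obtain ⟨s, hs⟩ := hne
  have h1 : (Scheme.IdealSheafData.vanishingIdeal C).support = ⊤ := Scheme.IdealSheafData.support_eq_top_iff.mpr h
  have h2 : s ∈ ((Scheme.IdealSheafData.vanishingIdeal C).support : Set S) := by
    rw [h1]
    exact Set.mem_univ s
  exact hs (vanishingIdeal_support_subset C F hCF h2)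

/-! ## §5 The generic Lemma A: descent along a tower -/

/-- **GENERIC LEMMA A — FULL-CENTRE DESCENT ALONG A TOWER.** Let `c` assign to every scheme a centre, supported — on every Noetherian integral
floor `S` and for every closed `F ⊆ S` off which `S` is FULL — inside `F` (`hc`); let `T : ℕ → Scheme → Prop` satisfy `T 0 S ⇒ S FULL at every
point` (`h0`) and `T (n+1) S ⇒ T n S₁` for every blowing up `S₁ ⟶ S` along `c S` (`hsucc`). Then for every `n`, every Noetherian integral `S`, every
closed `F` with a point off it, off which `S` is FULL: `T n S` implies that ONE centre `𝓚 ≠ ⊥` supported in `F` FULL-ifies `S` (every blowing up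
along `𝓚` is FULL at every point). Induction on `n` generalizing the floor: floor zero §1; at `n + 1` blow up `c S` (`exists_isBlowup`; the
centre is `≠ ⊥` since its support lies in `F ≠ S`, so the new floor is integral), transport the hypotheses (§2), apply the induction hypothesis on
the new floor inside `g⁻¹F`, and descend (§3). The desk's `IntrinsicTower.exists_fibreCentre_of_towerFull` is the instance `T := TowerFull p`,
`c := centre p` (R19.2). [folklore assembly; OURS] [cite: Temkin2008, Lemma 2.1.4] [cite: StacksProject, Tag 080B; Tag 02OS] -/
theorem exists_fullCentre_of_tower (p : ℕ) (T : ℕ → Scheme.{0} → Prop) (c : (S : Scheme.{0}) → S.IdealSheafData)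
    (hc : ∀ (S : Scheme.{0}) [IsNoetherian S] [IsIntegral S] (F : Set S), IsClosed F →
      (∀ s : S, s ∉ F → FullCl p (S.presheaf.stalk s)) → ((c S).support : Set S) ⊆ F)
    (h0 : ∀ (S : Scheme.{0}), T 0 S → ∀ s : S, FullCl p (S.presheaf.stalk s))
    (hsucc : ∀ (n : ℕ) (S : Scheme.{0}), T (n + 1) S → ∀ (S₁ : Scheme.{0}) (g : S₁ ⟶ S), IsBlowup g (c S) → T n S₁) :
    ∀ (n : ℕ) (S : Scheme.{0}) [IsNoetherian S] [IsIntegral S] (F : Set S), IsClosed F → (∃ s : S, s ∉ F) →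
      (∀ s : S, s ∉ F → FullCl p (S.presheaf.stalk s)) → T n S →
      ∃ 𝓚 : S.IdealSheafData, 𝓚 ≠ ⊥ ∧ (∀ s ∈ (𝓚.support : Set S), s ∈ F) ∧
        ∀ (S'' : Scheme.{0}) (π : S'' ⟶ S), IsBlowup π 𝓚 → ∀ s : S'', FullCl p (S''.presheaf.stalk s) := by
  intro n
  induction n with
  | zero =>
    intro S _ _ F _ hne _ hT
    obtain ⟨s, -⟩ := hne
    haveI : Nonempty S := ⟨s⟩
    exact exists_fullCentre_of_forall_fullCl p S F (h0 S hT)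
  | succ n ih =>
    intro S _ _ F hF hne hfull hT
    have hcF : ((c S).support : Set S) ⊆ F := hc S F hF hfull
    -- the centre is non-zero: its support lies in `F`, which misses a point
    have hcne : c S ≠ ⊥ := by
      intro h
      obtain ⟨s, hs⟩ := hne
      have h1 : (c S).support = ⊤ := Scheme.IdealSheafData.support_eq_top_iff.mpr h
      have h2 : s ∈ ((c S).support : Set S) := by
        rw [h1]
        exact Set.mem_univ s
      exact hs (hcF h2)
    -- blow up the centre: the next floor
    obtain ⟨S₁, g, hg⟩ := exists_isBlowup S (c S)
    haveI : IsIntegral S₁ := hg.isIntegral hcne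
    haveI : IsNoetherian S₁ := isNoetherian_of_isBlowup hg
    -- transport the hypotheses to the next floor and apply the induction hypothesis inside `g⁻¹F`
    obtain h₁ := ih S₁ (g.base ⁻¹' F) (hF.preimage g.continuous) (exists_not_mem_preimage_of_isBlowup hg F hcF hne)
      (fun s₁ hs₁ => fullCl_of_not_mem_preimage_of_isBlowup p hg F hcF hfull s₁ hs₁) (hsucc n S hT S₁ g hg)
    -- descend
    exact exists_fullCentre_of_isBlowup p hg F hcF h₁

end Summit.ResolutionOfSingularities.ResolutionOfSingularities.Theorems.FInjectiveMacaulayfication.FullCentreDescent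

end
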